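import Literature.NumberTheory.DiophantineGeometry.Conductor
import Literature.NumberTheory.GaloisRepresentations.ArtinConductor
import Literature.NumberTheory.EllipticCurves.TateModule
import Literature.NumberTheory.EllipticCurves.HasseWeilAbelian
import HarnessLib

-- provenance: harness21/H21/H21/Statements/BSD/Sweep1.lean @ 8bdf877 (interim HEAD d8f2665); M5 mechanical rewrite
/-!
# BSD family — statement sweep 1

Family `bsd` (gap inventory 2026-08-12), statement file `H21/Statements/BSD/Sweep1.lean`,
`namespace Literature.BSD`, `W` explicit (no dot-notation extensions of `WeierstrassCurve`). No new
definitions: everything is stated on top of the accepted preludes `DiophValNum.Conductor`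
(`WeierstrassCurve.conductorExponent`, `conductor`, `conductorNorm`, Ogg's formula),
`DiophValNum.LocalReduction` (reduction types at a place), `EllArithM.TateModule`
(`WeierstrassCurve.rationalTateGaloisRep`, the `ℓ`-adic representation `V_ℓ E`),
`EllArithM.HasseWeilAbelian` (`Literature.NumberTheory.EllipticCurves.conductorExponentOf`, `Literature.NumberTheory.EllipticCurves.conductorOf`, the prime-to-`ℓ` Artin
conductor of `V_ℓ E`, and the Ogg–Saito comparison theorems) and `GalRep.ArtinConductor`
(`Literature.NumberTheory.GaloisRepresentations.GaloisRep.artinConductorExponent`).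

## Covered inventory id

* **bsd.S15** (the conductor; Ogg 1967; Silverman *ATAEC* IV.10–11; Serre–Tate 1968):
  `N_E = ∏ p^{f_p}` with `f_p` given by Ogg's formula (`factorization_conductorNorm_eq_oggFormula`),
  `f_p` by reduction type *including the bounds at `2` and `3`* (`f_2 ≤ 8`, `f_3 ≤ 5`, `f_p ≤ 2`
  for `p ≥ 5`; `conductorExponent_by_reduction_type`), and the clause "`N_E` is the Artin
  conductor of `V_ℓ(E)`" over a general number field `K`: exponentwise, `f_v = a_v(V_ℓ E)` for
  every finite place `v ∤ ℓ` (`conductorExponent_eq_artinConductorExponent_tateModule`), and as an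
  equality of ideals of `𝓞 K`, `𝔣(E/K) = 𝔣^{(ℓ)}(V_ℓ E)` for `ℓ` prime to `𝔣(E/K)`
  (`conductor_eq_conductorOf_tateModule`).  All four are *proved* restatements of prelude
  results (no new `sorry`); since D-0014 those prelude results are named facts (`Prop`-valued
  `def`s), taken here as explicit hypotheses.  The sibling item file `Statements/BSD/Conductor.lean` carries the
  `K = ℚ` numerical forms (`N_E = conductorNatOf`, `finprod` over `Nat.Primes`, `p ≥ 5` via the
  Kodaira symbol); the statements here are the complementary ones (bounds at `2, 3`; number-field
  generality) and deliberately do not repeat those.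

## Ids of the round NOT covered here, with the missing notion

bsd.S11, S14, S19, S22, S25, S28, S31, S33, S34, S36 are covered by the sibling statement files
`Selmer`, `NeronTamagawa`, `Iwasawa`, `ComplexMultiplication`, `RootNumber`, `FunctionField` and are
not restated.  Still missing (planned prelude items in brackets):

* bsd.S16 (Gross–Zagier), bsd.S37 (modular parametrisation, Manin constant, Heegner points):
  `X₀(N) → E` and Heegner points `P_K ∈ E(K)` [`ModularCurve`, `HeegnerPoints`].
* bsd.S20 (Kato), bsd.S21 (Skinner–Urban): the `Λ`-module `X(E/ℚ_∞)` (dual Selmer over the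
  cyclotomic tower; no Selmer groups of the layers `κ.layer n` of `Literature.NumberTheory.EllipticCurves.ZpExtension` nor
  restriction maps between them exist yet) [`IwasawaSelmer`] and `L_p(E,T)` [`PAdicLFunction`].
* bsd.S23 (MSD/MTT `p`-adic `L`-function): modular symbols and periods `Ω^±` of `f_E`
  [`ModularSymbols`, `PAdicLFunction`].
* bsd.S24 (`p`-adic BSD): `L_p(E,T)` [`PAdicLFunction`]; the `p`-adic regulator and
  `𝓛`-invariant now exist (`EllArithM.PAdicHeights`).
* bsd.S32 (BSD for abelian varieties, Tate's form): Mordell–Weil group, dual abelian variety,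
  Néron–Tate regulator, periods, Tamagawa numbers and `Ш` of an `Literature.AbelianVariety K`; only the
  Galois side (`Literature.NumberTheory.EllipticCurves.hasseWeilLFunction` of a discrete `Γ_K`-module) exists.
* bsd.S38 (Euler/Kolyvagin systems): classes in `H¹(K(μ_n), T_p E)` over varying fields with
  *corestriction* maps (`Literature.NumberTheory.GaloisRepresentations.galoisCohomology` has `res`, no `cores`) [`EulerSystems`].

## Design choices

* **Artin clause of bsd.S15.** `V_ℓ E` is the prelude's `WeierstrassCurve.rationalTateGaloisRep W ℓ h
  : Literature.GaloisRep K ℚ_[ℓ] (V_ℓ E)` (definitionally `Literature.rationalTateGaloisRepOf (geomPoints W) ℓ h`,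
  `WeierstrassCurve.rationalTateGaloisRep_eq_rationalTateGaloisRepOf`), whose joint-continuity
  witness `h` is an explicit argument of the prelude definition; it is universally quantified here
  (it is supplied by the sorried prelude theorem `WeierstrassCurve.continuous_rationalGaloisRepTate`,
  and by proof irrelevance the statement does not depend on it). The Artin exponent `a_v` is
  `GalRep.artinConductorExponent v` (Swan conductor via the upper-numbering filtration,
  `GalRep.ArtinConductor`), meaningful at `v ∤ ℓ` where the wild inertia acts through a finite
  quotient (Serre–Tate); the hypothesis `hℓ : (ℓ : 𝓞 K) ∉ v` encodes `v ∤ ℓ` (at `v ∣ ℓ` the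
  `ℓ`-adic exponent is junk, whence the prime-to-`ℓ` conductor ideal `Literature.NumberTheory.EllipticCurves.conductorOf`).
* Ogg's formula uses `ℕ`-subtraction `ord_p(Δ_min) + 1 - m_p`, which does not truncate since
  `m_p ≤ ord_p(Δ_min) + 1` (`WeierstrassCurve.numComponentsAt_le`, `TateAlgorithm`), as recorded in
  `Conductor`.
* `noncomputable section`, no `[DecidableEq]` variables, universe `u` for the
  Galois-representation part (`K : Type u`, forced by `TateModule`/`GaloisRep`).
* Mathlib search (pin v4.32.0): Mathlib has `WeierstrassCurve` reduction predicates over a DVR but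
  no conductor of an elliptic curve and no Artin conductor (grep `conductor` in
  `Mathlib/AlgebraicGeometry/EllipticCurve`, `artinConductor`: nothing); `Nat.factorization`,
  `HeightOneSpectrum`, `NumberField.RingOfIntegers` are used.
-/

noncomputable section

open NumberField IsDedekindDomain WeierstrassCurve

universe u

namespace Literature.NumberTheory.EllipticCurves

/-! ## bsd.S15 — the conductor: Ogg's formula and reduction types -/

section ConductorDef

variable (W : WeierstrassCurve ℚ) [W.IsElliptic]

/-- **bsd.S15** (the conductor `N_E = ∏_p p^{f_p}`; Ogg, *Elliptic curves and wild ramification*,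
Amer. J. Math. 89 (1967); Silverman, *ATAEC*, IV.10–11). The conductor of `E/ℚ` is
`N_E = W.conductorNorm ℤ` (`Literature.Prelude.DiophValNum.Conductor`), the positive integer whose exponent
at each prime `p` is the conductor exponent `f_p = W.conductorExponent v_p`, itself defined by Ogg's
formula `f_p = ord_p(Δ_min) + 1 - m_p` (`m_p` = number of components of the special fibre, from
Tate's algorithm; the `ℕ`-subtraction does not truncate since `m_p ≤ ord_p(Δ_min) + 1`,
`WeierstrassCurve.numComponentsAt_le`), which agrees with `ε_p + δ_p` (tame + Swan conductor of
`V_ℓ E`) by Ogg–Saito. Restatement (with the inventory tag) of the named fact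
`WeierstrassCurve.factorization_conductorNorm` (hypothesis `hf`, D-0014). [folklore] -/
theorem factorization_conductorNorm_eq_oggFormula (v : HeightOneSpectrum ℤ)
    (hf : W.factorization_conductorNorm v) :
    (W.conductorNorm ℤ).factorization (Rat.HeightOneSpectrum.natGenerator v) =
        W.ordMinimalDiscriminant v + 1 - W.numComponentsAt v :=
  hf

/-- **bsd.S15** (conductor exponents by reduction type; Silverman, *ATAEC*, IV.10.2 and IV.10.4;
Ogg 1967). `f_p = 0` iff good reduction, `f_p = 1` iff multiplicative reduction, `f_p ≥ 2` iff
additive reduction, with `f_p = 2` for additive `p ≥ 5`, `f_2 ≤ 8`, `f_3 ≤ 5`. Restated from the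
prelude (`conductorExponent_eq_zero_iff`, `…_eq_one_iff`, `two_le_conductorExponent_iff`,
`conductorExponent_le_eight`, `…_le_five_…`, `…_le_two_…`, now named facts taken as the
hypotheses `h0`, `h1`, `h2`, `h8`, `h5`, `h2'`, D-0014) as one conjunction over `ℚ`. [cite: Ogg1967] -/
theorem conductorExponent_by_reduction_type (v : HeightOneSpectrum ℤ)
    (h0 : conductorExponent_eq_zero_iff v W) (h1 : conductorExponent_eq_one_iff v W)
    (h2 : two_le_conductorExponent_iff v W) (h8 : W.conductorExponent_le_eight v)
    (h5 : W.conductorExponent_le_five_of_natGenerator_eq_three v)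
    (h2' : W.conductorExponent_le_two_of_five_le_natGenerator v) :
    (W.conductorExponent v = 0 ↔ W.HasGoodReductionAt v) ∧
      (W.conductorExponent v = 1 ↔ W.HasMultiplicativeReductionAt v) ∧
      (2 ≤ W.conductorExponent v ↔ W.HasAdditiveReductionAt v) ∧
      W.conductorExponent v ≤ 8 ∧
      (Rat.HeightOneSpectrum.natGenerator v = 3 → W.conductorExponent v ≤ 5) ∧
      (5 ≤ Rat.HeightOneSpectrum.natGenerator v → W.conductorExponent v ≤ 2) :=
  ⟨h0, h1, h2, h8, h5, h2'⟩

end ConductorDef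

/-! ## bsd.S15 — the conductor as the Artin conductor of `V_ℓ E` -/

section ArtinConductor

variable {K : Type u} [Field K] [NumberField K] (W : WeierstrassCurve K) [W.IsElliptic]

omit [W.IsElliptic] in
/-- **bsd.S15** (the conductor is the Artin conductor of the `ℓ`-adic representation; Serre–Tate,
*Good reduction of abelian varieties*, Ann. of Math. 88 (1968), §2–3; Ogg 1967; Silverman,
*ATAEC*, IV.10 (definition of `f_v` via `V_ℓ E`) with IV.11 (Ogg–Saito formula)). For an elliptic
curve `E` over a number field `K`, a finite place `v` and any prime `ℓ` not below `v`, the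
conductor exponent `f_v(E)` (defined in `DiophValNum.Conductor` by Ogg's formula) equals the Artin
conductor exponent `a_v(V_ℓ E) = codim V^{I_v} + sw_v(V)` of the rational `ℓ`-adic Tate module
`V_ℓ E = WeierstrassCurve.rationalTateGaloisRep W ℓ h` (`GalRep.ArtinConductor`); in particular
`a_v(V_ℓ E)` is an integer independent of `ℓ ∤ v`. The continuity witness `h` is universally
quantified (supplied by `WeierstrassCurve.continuous_rationalGaloisRepTate`).  Restatement, over a
general number field and with the inventory tag, of the prelude theorem
`WeierstrassCurve.artinConductorExponent_tate_eq_conductorExponent` (`EllArithM.HasseWeilAbelian`),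
now a named fact taken as the hypothesis `hA` (D-0014). [cite: Ogg1967] -/
theorem conductorExponent_eq_artinConductorExponent_tateModule (v : HeightOneSpectrum (𝓞 K))
    (ℓ : ℕ) [Fact ℓ.Prime] (hA : W.artinConductorExponent_tate_eq_conductorExponent ℓ)
    (hℓ : (ℓ : 𝓞 K) ∉ v.asIdeal)
    (h : Continuous fun x : Field.absoluteGaloisGroup K × W.rationalTateModule ℓ =>
      rationalGaloisRepTate W ℓ x.1 x.2) :
    W.conductorExponent v =
      GaloisRepresentations.GaloisRep.artinConductorExponent v (W.rationalTateGaloisRep ℓ h) :=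
  (hA h v hℓ).symm

omit [W.IsElliptic] in
/-- **bsd.S15** (the conductor ideal is the Artin conductor of `V_ℓ E`; Serre–Tate, Ann. of
Math. 88 (1968), §2.1 and Thm 3; Silverman, *ATAEC*, IV.10–11).  For an elliptic curve `E` over
a number field `K` and a prime `ℓ` such that `f_v(E) = 0` at every place `v ∣ ℓ` (i.e. `ℓ` is
prime to the conductor, e.g. `E` has good reduction above `ℓ`), the conductor ideal
`𝔣(E/K) = ∏_v v^{f_v} = W.conductor (𝓞 K)` (`DiophValNum.Conductor`) equals the prime-to-`ℓ`
Artin conductor ideal `𝔣^{(ℓ)}(V_ℓ E) = ∏_{v ∤ ℓ} v^{a_v(V_ℓ E)} = Literature.conductorOf (geomPoints W) ℓ h`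
of the `ℓ`-adic representation (`EllArithM.HasseWeilAbelian`; the factors at `v ∣ ℓ` are omitted
there because the `ℓ`-adic exponent is junk, and are `1` here by `hℓ`).  Restatement over a
general number field of `WeierstrassCurve.artinConductor_tate_eq_conductor`; the numerical form
`N_E = conductorNatOf` for `K = ℚ` is `Literature.NumberTheory.EllipticCurves.conductorNorm_eq_artinConductorNat`
(`Statements/BSD/Conductor.lean`).  The prelude result is now a named fact, taken as the
hypothesis `hA` (D-0014). [folklore] -/
theorem conductor_eq_conductorOf_tateModule (ℓ : ℕ) [Fact ℓ.Prime]
    (hA : W.artinConductor_tate_eq_conductor ℓ)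
    (hℓ : ∀ v : HeightOneSpectrum (𝓞 K), (ℓ : 𝓞 K) ∈ v.asIdeal → W.conductorExponent v = 0)
    (h : Continuous fun x : Field.absoluteGaloisGroup K × W.rationalTateModule ℓ =>
      rationalGaloisRepTate W ℓ x.1 x.2) :
    W.conductor (𝓞 K) = conductorOf (geomPoints W) ℓ h :=
  (hA h hℓ).symm

end ArtinConductor

end Literature.NumberTheory.EllipticCurves

end
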